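import Literature.AlgebraicGeometry.HodgeTheory.CyclicCoverPencilModelIsotopy
import Literature.AlgebraicGeometry.HodgeTheory.CyclicCoverPencilSolvedVector
import Literature.Geometry.ComplexAnalytic.CyclicNodePencilShellSubmersion
import Literature.Geometry.ComplexAnalytic.PhamBrieskornCyclicNodeCohomology
import HarnessLib

/-!
# The model isotopy of the nodal pencil: coordinates, pencil coordinate and Morse radius of `J(θ, x)`

Family `hodge`, layer `Literature/AlgebraicGeometry/HodgeTheory`; step A3b (second part). For the chart `Φ = regChartFun 2 p 2` of `𝒴°(ℂ)₂`, the
Morse chart `Θ` of the pencil (`Σ (Θ y)ᵢ^{eᵢ} = φ(y)`), a point `x` with remaining coefficients `b'₀`, affine coordinates `y(x)` in the chart ball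
`{Σ|Θ y|² < r²}` (`{Σ|z|² ≤ r²} ⊆ Θ.target`) and pencil coordinate `c = pencilCoord x` with `0 < |c| < ρW`, and assuming the pencil members
`x₃^p = f₁ + c'x₂^p`, `0 < |c'| < ρW`, are nonsingular: the point `J(θ, x) = chartModelIsotopy e Φ Θ θ x` lies in the chart domain, has remaining
coefficients `b'₀`, affine coordinates `Θ⁻¹ R_θ Θ y(x)`, pencil coordinate `e^{iθ} c`, and the same Morse radius.

* `chartModelIsotopy_nodal_spec` — membership and chart coordinates;
* `regCoeff_chartModelIsotopy`, `pencilCoord_chartModelIsotopy`, `sum_norm_sq_chartModelIsotopy`.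

Everything is proved; no definitions, no named facts.

## References

* [Milnor1968] J. Milnor, Singular Points of Complex Hypersurfaces (1968), §9 Lemma 9.4.
* [CarlsonToledo1999] J. A. Carlson, D. Toledo, Duke Math. J. 97 (1999), §6 (kdoublept).
-/

noncomputable section

open MvPolynomial Set Function Complex
open Literature.AlgebraicGeometry.Motives Literature.AlgebraicGeometry.Motives.UniversalHypersurface
open Literature.AlgebraicGeometry.HodgeTheory.UniversalHypersurface Literature.Geometry.ComplexAnalytic

namespace Literature.AlgebraicGeometry.HodgeTheory

section Spec

variable {p : ℕ} (hp : 3 ≤ p)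
  (Φ : OpenPartialHomeomorph (ComplexPoints (regularTotal ℂ 2 p)) (({m : DegIndex 2 p // m ≠ regPowIndex 2 p 2} ⊕ Fin (2 + 1)) → ℂ))
  (hΦ : ⇑Φ = regChartFun 2 p 2) (hΦs : Φ.source = regChartDom 2 p 2) (hΦt : Φ.target = regChartFun 2 p 2 '' regChartDom 2 p 2)
  (Θ : OpenPartialHomeomorph (Fin (1 + 2) → ℂ) (Fin (1 + 2) → ℂ)) {r : ℝ}
  (hr : {z : Fin (1 + 2) → ℂ | ∑ i, ‖z i‖ ^ 2 ≤ r ^ 2} ⊆ Θ.target)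
  (hΘφ : ∀ x ∈ Θ.source, ∑ i, (Θ x) i ^ PhamBrieskorn.cyclicNodeExponents p i = x 2 ^ p - (x 0 * x 1 + x 0 ^ p + x 1 ^ p))
  {ρW : ℝ}
  (hns : ∀ c : ℂ, c ≠ 0 → ‖c‖ < ρW → SmoothHypersurface.IsNonsingularForm ℂ (formOfCoeffs
    (coeffsOf 2 p (cyclicCoverForm p (X 2 ^ (p - 2) * (X 0 * X 1) + X 0 ^ p + X 1 ^ p)) - Pi.single (regPowIndex 2 p 2) c)))
  {x : ComplexPoints (regularTotal ℂ 2 p)} (hx : x ∈ Φ.source)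
  (hb : ∀ m : {m : DegIndex 2 p // m ≠ regPowIndex 2 p 2},
    regCoeff ℂ 2 p x m.1 = coeffsOf 2 p (cyclicCoverForm p (X 2 ^ (p - 2) * (X 0 * X 1) + X 0 ^ p + X 1 ^ p)) m.1)
  (hy : (fun j => regChartFun 2 p 2 x (Sum.inr j)) ∈ Θ.source)
  (hyr : ∑ i, ‖Θ (fun j => regChartFun 2 p 2 x (Sum.inr j)) i‖ ^ 2 < r ^ 2)
  (hc0 : pencilCoord p x ≠ 0) (hcρ : ‖pencilCoord p x‖ < ρW) (θ : ℝ)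
include hp hΦ hΦs hΦt hr hΘφ hns hx hb hy hyr hc0 hcρ

omit hΦ hΦt hns hc0 hcρ in
/-- The rotated affine coordinates have pencil value `e^{iθ} c`. [cite: Milnor1968, §9 Lemma 9.4] -/
theorem phi_rotated_eq :
    (fun y : Fin (1 + 2) → ℂ => y 2 ^ p - (y 0 * y 1 + y 0 ^ p + y 1 ^ p))
        (Θ.symm (fun k => Complex.exp (((θ / PhamBrieskorn.cyclicNodeExponents p k : ℝ) : ℂ) * I) *
          Θ (fun j => regChartFun 2 p 2 x (Sum.inr j)) k)) =
      Complex.exp ((θ : ℂ) * I) * pencilCoord p x := by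
  have hxd : x ∈ regChartDom 2 p 2 := hΦs ▸ hx
  have h1 := PhamBrieskorn.apply_modelIsotopy_eq_exp_mul (PhamBrieskorn.cyclicNodeExponents p) Θ
    (fun k => by have := PhamBrieskorn.two_le_cyclicNodeExponents (p := p) (by omega) k; omega) hr hΘφ hy hyr θ
  have h2 := pencilCoord_eq_phi p hp hxd hb
  simp only at h1 h2 ⊢
  rw [h2]
  exact h1

/-- **`J(θ, x)` lies in the chart domain with chart coordinates `(b'₀, Θ⁻¹ R_θ Θ y(x))`.** [cite: Milnor1968, §9 Lemma 9.4] -/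
theorem chartModelIsotopy_nodal_spec :
    chartModelIsotopy (PhamBrieskorn.cyclicNodeExponents p) Φ Θ θ x ∈ Φ.source ∧
      Φ (chartModelIsotopy (PhamBrieskorn.cyclicNodeExponents p) Φ Θ θ x) =
        Sum.elim (fun m => Φ x (Sum.inl m))
          (Θ.symm (fun k => Complex.exp (((θ / PhamBrieskorn.cyclicNodeExponents p k : ℝ) : ℂ) * I) *
            Θ (fun j => Φ x (Sum.inr j)) k)) := by
  refine chartModelIsotopy_mem_and_apply (PhamBrieskorn.cyclicNodeExponents p) Φ Θ (by omega) hΦt hx ?_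
  -- the solved form at the rotated coordinates is the pencil member over `e^{iθ} c`
  have hb' : (fun m : {m : DegIndex 2 p // m ≠ regPowIndex 2 p 2} => Φ x (Sum.inl m)) =
      fun m => coeffsOf 2 p (cyclicCoverForm p (X 2 ^ (p - 2) * (X 0 * X 1) + X 0 ^ p + X 1 ^ p)) m.1 := by
    funext m; rw [hΦ]; exact hb m
  rw [hb', hΦ, regChartCoeffVec_nodalPencil_eq p hp]
  have hφ := phi_rotated_eq hp Φ hΦs Θ hr hΘφ hx hb hy hyr θ
  simp only at hφ
  rw [hφ]
  refine hns _ (mul_ne_zero (Complex.exp_ne_zero _) hc0) ?_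
  rw [norm_mul, Complex.norm_exp_ofReal_mul_I, one_mul]; exact hcρ

/-- **The remaining coefficients of `J(θ, x)` are `b'₀`.** [cite: CarlsonToledo1999, §6 (kdoublept)] -/
theorem regCoeff_chartModelIsotopy (m : {m : DegIndex 2 p // m ≠ regPowIndex 2 p 2}) :
    regCoeff ℂ 2 p (chartModelIsotopy (PhamBrieskorn.cyclicNodeExponents p) Φ Θ θ x) m.1 =
      coeffsOf 2 p (cyclicCoverForm p (X 2 ^ (p - 2) * (X 0 * X 1) + X 0 ^ p + X 1 ^ p)) m.1 := by
  obtain ⟨-, hJ⟩ := chartModelIsotopy_nodal_spec hp Φ hΦ hΦs hΦt Θ hr hΘφ hns hx hb hy hyr hc0 hcρ θ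
  have h := congrFun hJ (Sum.inl m)
  rw [hΦ] at h
  change regCoeff ℂ 2 p _ m.1 = regCoeff ℂ 2 p x m.1 at h
  rw [h]; exact hb m

/-- **The affine coordinates of `J(θ, x)` are the rotated ones.** [cite: Milnor1968, §9 Lemma 9.4] -/
theorem affine_chartModelIsotopy :
    (fun j => regChartFun 2 p 2 (chartModelIsotopy (PhamBrieskorn.cyclicNodeExponents p) Φ Θ θ x) (Sum.inr j)) =
      Θ.symm (fun k => Complex.exp (((θ / PhamBrieskorn.cyclicNodeExponents p k : ℝ) : ℂ) * I) *
        Θ (fun j => regChartFun 2 p 2 x (Sum.inr j)) k) := by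
  obtain ⟨-, hJ⟩ := chartModelIsotopy_nodal_spec hp Φ hΦ hΦs hΦt Θ hr hΘφ hns hx hb hy hyr hc0 hcρ θ
  funext j
  have h := congrFun hJ (Sum.inr j)
  rw [hΦ] at h
  exact h

/-- **The pencil coordinate of `J(θ, x)` is `e^{iθ} c`.** [cite: Milnor1968, §9 Lemma 9.4] -/
theorem pencilCoord_chartModelIsotopy :
    pencilCoord p (chartModelIsotopy (PhamBrieskorn.cyclicNodeExponents p) Φ Θ θ x) =
      Complex.exp ((θ : ℂ) * I) * pencilCoord p x := by
  obtain ⟨hJs, -⟩ := chartModelIsotopy_nodal_spec hp Φ hΦ hΦs hΦt Θ hr hΘφ hns hx hb hy hyr hc0 hcρ θ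
  have hJd : chartModelIsotopy (PhamBrieskorn.cyclicNodeExponents p) Φ Θ θ x ∈ regChartDom 2 p 2 := hΦs ▸ hJs
  rw [pencilCoord_eq_phi p hp hJd (regCoeff_chartModelIsotopy hp Φ hΦ hΦs hΦt Θ hr hΘφ hns hx hb hy hyr hc0 hcρ θ)]
  have hA := affine_chartModelIsotopy hp Φ hΦ hΦs hΦt Θ hr hΘφ hns hx hb hy hyr hc0 hcρ θ
  have hA' : ∀ j, regChartFun 2 p 2 (chartModelIsotopy (PhamBrieskorn.cyclicNodeExponents p) Φ Θ θ x) (Sum.inr j) =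
      Θ.symm (fun k => Complex.exp (((θ / PhamBrieskorn.cyclicNodeExponents p k : ℝ) : ℂ) * I) *
        Θ (fun j => regChartFun 2 p 2 x (Sum.inr j)) k) j := fun j => congrFun hA j
  have hφ := phi_rotated_eq hp Φ hΦs Θ hr hΘφ hx hb hy hyr θ
  simp only at hφ ⊢
  rw [hA', hA', hA']
  exact hφ

/-- **The Morse radius of `J(θ, x)` equals that of `x`** (and its affine coordinates lie in `Θ.source`). [cite: Milnor1968, §9 Lemma 9.4] -/
theorem sum_norm_sq_chartModelIsotopy :
    (fun j => regChartFun 2 p 2 (chartModelIsotopy (PhamBrieskorn.cyclicNodeExponents p) Φ Θ θ x) (Sum.inr j)) ∈ Θ.source ∧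
      ∑ i, ‖Θ (fun j => regChartFun 2 p 2 (chartModelIsotopy (PhamBrieskorn.cyclicNodeExponents p) Φ Θ θ x) (Sum.inr j)) i‖ ^ 2 =
        ∑ i, ‖Θ (fun j => regChartFun 2 p 2 x (Sum.inr j)) i‖ ^ 2 := by
  obtain ⟨hmem, happ, -⟩ := PhamBrieskorn.modelIsotopy_mem (PhamBrieskorn.cyclicNodeExponents p) Θ hr hyr θ
  rw [affine_chartModelIsotopy hp Φ hΦ hΦs hΦt Θ hr hΘφ hns hx hb hy hyr hc0 hcρ θ]
  refine ⟨hmem, ?_⟩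
  rw [happ, PhamBrieskorn.sum_norm_sq_weightedRotation]

end Spec

end Literature.AlgebraicGeometry.HodgeTheory

end
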